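import Literature.Computability.QuantumComplexity.PauliMomentStabilizerBounds

/-!
# The Pauli spectrum of a stabilizer-framed state: eigen-relations, commutation, an entangled frame

Sequel of `PauliMomentStabilizerBounds.lean` (namespace `Literature.Computability.QuantumComplexity.PauliMoments`):
what an inhabitant of the hypothesis-structure `StabFrame s` (`|s⟩⟨s| = 2⁻ⁿ Σ_T ε_T σ_{w(T)}`) IS.
* (T4a) spectrum: `a_{w(T)}(s) = ε_T`, `a_S(s) = 0` off the frame words, `Σ_T |ε_T|² = 2ⁿ‖s‖⁴`, `‖s‖² ≤ 1`;
* (T4b) UNIT framed states: `σ_{w(T)} s = ε_T s`, `ε_T² = 1`, and (T4b′) the frame words PAIRWISE COMMUTE as matrices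
  — `2ⁿ` distinct, commuting, `±`-signed Pauli words fixing `s` [AaronsonGottesman2004, Thm 1; NielsenChuang2010,
  §10.5.1] (the closing count «these words generate a group of order ≤ 2ⁿ» is not typed here);
* (T4c) an ENTANGLED inhabitant: the Bell state carries the frame `{II, XX, −YY, ZZ}` and is not a product state.

## References

* [AaronsonGottesman2004] Phys. Rev. A 70 (2004) 052328, Thm 1, §II. [NielsenChuang2010] CUP 2010, §10.5.1 eq. (10.88).
* [KempeEtAl2010] J. Kempe, O. Regev, F. Unger, R. de Wolf, Quantum Inf. Comput. 10 (2010) 361, §2.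
-/

noncomputable section

open Matrix Finset Literature.Computability.QuantumComplexity

namespace Literature.Computability.QuantumComplexity.PauliMoments

variable {n : ℕ} {s : Reg n → ℂ}

/-! ### (T4a) The Pauli spectrum of a framed state -/

/-- The projector of a framed state as a matrix combination of its frame words:
`|s⟩⟨s| = Σ_T (ε_T/2ⁿ) σ_{w(T)}`. [cite: NielsenChuang2010, §10.5.1] -/
theorem StabFrame.proj_eq (F : StabFrame s) :
    proj s = ∑ T, ((F.sign T / 2 ^ n : ℂ) • pauliString (F.word T)) := by
  ext x y
  simp only [proj, Matrix.of_apply, Matrix.sum_apply, Matrix.smul_apply, smul_eq_mul]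
  rw [F.frame x y, div_eq_mul_inv, Finset.sum_mul]
  refine Finset.sum_congr rfl fun T _ => ?_
  rw [div_eq_mul_inv]
  ring

/-- The Pauli spectrum of a framed state: `a_S(s) = Σ_T ε_T·[S = w(T)]` (Hilbert–Schmidt orthogonality
of Pauli words, `Tr(σ_S σ_{S'}) = 2ⁿ [S = S']`). [cite: KempeEtAl2010, §2] -/
theorem StabFrame.pauliExp_eq_sum (F : StabFrame s) (S : PWord n) :
    pauliExp s S = ∑ T, if S = F.word T then F.sign T else 0 := by
  unfold pauliExp
  rw [pauliCoeff_eq, F.proj_eq, Matrix.mul_sum, Matrix.trace_sum]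
  refine Finset.sum_congr rfl fun T _ => ?_
  rw [Matrix.mul_smul, Matrix.trace_smul, trace_pauliString_mul_pauliString, Fintype.card_fin,
    smul_eq_mul]
  have h2 : (2 : ℂ) ^ n ≠ 0 := pow_ne_zero _ two_ne_zero
  split_ifs with h
  · field_simp
  · simp

/-- On a frame word the Pauli expectation is the frame sign: `a_{w(T)}(s) = ε_T`.
[cite: AaronsonGottesman2004, Thm 1] -/
theorem StabFrame.pauliExp_word (F : StabFrame s) (T : Reg n) :
    pauliExp s (F.word T) = F.sign T := by
  rw [F.pauliExp_eq_sum, Finset.sum_eq_single T]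
  · simp
  · intro T' _ hT'
    rw [if_neg]
    exact fun h => hT' (F.word_injective h.symm)
  · intro h; exact absurd (Finset.mem_univ T) h

/-- Off the frame words the Pauli expectation vanishes: `a_S(s) = 0` if `S ∉ {w(T)}`.
[cite: AaronsonGottesman2004, Thm 1] -/
theorem StabFrame.pauliExp_eq_zero (F : StabFrame s) {S : PWord n} (hS : ∀ T, S ≠ F.word T) :
    pauliExp s S = 0 := by
  rw [F.pauliExp_eq_sum]
  exact Finset.sum_eq_zero fun T _ => if_neg (hS T)

/-- The squared norm of a framed state is the sign of the identity word: `‖s‖² = ε_{0ⁿ}`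
(the trace of the frame identity). [cite: NielsenChuang2010, §10.5.1 eq.] -/
theorem StabFrame.normSq_eq_sign_zero (F : StabFrame s) :
    (normSq s : ℂ) = F.sign (fun _ => false) := by
  rw [← pauliExp_idWord, ← F.word_zero, F.pauliExp_word]

/-- Hilbert–Schmidt norm of a framed state's projector: `Σ_T |ε_T|² = 2ⁿ ‖s‖⁴`
(Parseval `Σ_S |a_S(s)|² = 2ⁿ‖s‖⁴` + the spectrum formula). [cite: KempeEtAl2010, Lemma 7] -/
theorem StabFrame.sum_norm_sign_sq (F : StabFrame s) :
    ∑ T, ‖F.sign T‖ ^ 2 = 2 ^ n * normSq s ^ 2 := by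
  rw [← sum_norm_pauliExp_sq s]
  have himg : ∑ S ∈ Finset.univ.image F.word, ‖pauliExp s S‖ ^ 2 = ∑ T, ‖F.sign T‖ ^ 2 := by
    rw [Finset.sum_image fun T _ T' _ h => F.word_injective h]
    exact Finset.sum_congr rfl fun T _ => by rw [F.pauliExp_word]
  rw [← himg]
  exact Finset.sum_subset (Finset.subset_univ _) fun S _ hS => by
    rw [F.pauliExp_eq_zero fun T hT => hS (Finset.mem_image.2 ⟨T, Finset.mem_univ _, hT.symm⟩),
      norm_zero, zero_pow two_ne_zero]

/-- Framed states are SUB-NORMALISED, `‖s‖² ≤ 1` (as `Σ_T |ε_T|² ≤ 2ⁿ`): the weight `‖c‖₁` of the Core's class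
ceiling (T0) is never undercut by hiding norm in the frame states. [cite: KempeEtAl2010, Lemma 7] -/
theorem StabFrame.normSq_le_one (F : StabFrame s) : normSq s ≤ 1 := by
  have h0 : 0 ≤ normSq s := Finset.sum_nonneg fun x _ => by positivity
  have h1 : 2 ^ n * normSq s ^ 2 ≤ 2 ^ n * 1 := by
    rw [← F.sum_norm_sign_sq, mul_one]
    calc ∑ T, ‖F.sign T‖ ^ 2 ≤ ∑ _T : Reg n, (1 : ℝ) :=
          Finset.sum_le_sum fun T _ => by
            have := F.norm_sign_le T
            nlinarith [norm_nonneg (F.sign T)]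
      _ = 2 ^ n := by simp [Finset.card_univ, Fintype.card_fin, Fintype.card_bool, Fintype.card_pi]
  have h2 : normSq s ^ 2 ≤ 1 := le_of_mul_le_mul_left h1 (by positivity)
  nlinarith

/-- A UNIT framed state has all frame signs of modulus one: `‖s‖² = 1 ⇒ |ε_T| = 1` for every `T` (`2ⁿ` terms,
each at most `1`, summing to `2ⁿ`); with `pauliExp_word`, `|⟨s|σ_{w(T)}|s⟩| = 1` on `2ⁿ` distinct words.
[cite: AaronsonGottesman2004, Thm 1] -/
theorem StabFrame.norm_sign_eq_one (F : StabFrame s) (hs : normSq s = 1) (T : Reg n) :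
    ‖F.sign T‖ = 1 := by
  have hsum : ∑ T, (1 - ‖F.sign T‖ ^ 2) = (0 : ℝ) := by
    rw [Finset.sum_sub_distrib, F.sum_norm_sign_sq, hs]
    simp [Finset.card_univ, Fintype.card_fin, Fintype.card_bool, Fintype.card_pi]
  have hnn : ∀ T ∈ (Finset.univ : Finset (Reg n)), 0 ≤ 1 - ‖F.sign T‖ ^ 2 := fun T _ => by
    have := F.norm_sign_le T
    nlinarith [norm_nonneg (F.sign T)]
  have hT := (Finset.sum_eq_zero_iff_of_nonneg hnn).1 hsum T (Finset.mem_univ T)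
  have h0 : 0 ≤ ‖F.sign T‖ := norm_nonneg _
  nlinarith [F.norm_sign_le T]

/-! ### (T4b) The stabilizer property of unit framed states; (T4b′) their frame words commute -/

/-- `‖ψ‖²` as the complex self-pairing `ψ† ψ`. [cite: NielsenChuang2010, §2.1.4] -/
theorem normSq_coe (ψ : Reg n → ℂ) : (normSq ψ : ℂ) = star ψ ⬝ᵥ ψ := by
  unfold normSq
  push_cast
  simp only [dotProduct, Pi.star_apply, Complex.star_def, Complex.conj_mul']

/-- `a_S(ψ) = ψ† (σ_S ψ)`. [cite: NielsenChuang2010, §2.2.5 eq.] -/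
theorem pauliExp_eq_dotProduct (ψ : Reg n → ℂ) (S : PWord n) :
    pauliExp ψ S = star ψ ⬝ᵥ (pauliString S *ᵥ ψ) := by
  rw [pauliExp_eq]
  simp only [dotProduct, Matrix.mulVec, Pi.star_apply, Finset.mul_sum]
  refine Finset.sum_congr rfl fun y _ => Finset.sum_congr rfl fun x _ => ?_
  ring

/-- Pauli words are unitary: `σ_S† σ_S = 1`. [cite: NielsenChuang2010, §2.1.6 and Fig. 2.2] -/
theorem conjTranspose_pauliString_mul_self (S : PWord n) :
    (pauliString S)ᴴ * pauliString S = 1 := by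
  rw [conjTranspose_pauliString, pauliString_mul_self]

/-- Pauli words preserve the norm: `‖σ_S ψ‖² = ‖ψ‖²`. [cite: NielsenChuang2010, §2.1.6] -/
theorem normSq_mulVec (S : PWord n) (ψ : Reg n → ℂ) :
    normSq (pauliString S *ᵥ ψ) = normSq ψ := by
  have h : (normSq (pauliString S *ᵥ ψ) : ℂ) = (normSq ψ : ℂ) := by
    rw [normSq_coe, normSq_coe, Matrix.star_mulVec, Matrix.dotProduct_mulVec, Matrix.vecMul_vecMul,
      conjTranspose_pauliString_mul_self, Matrix.vecMul_one]
  exact_mod_cast h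

/-- A vector of squared norm zero vanishes. [cite: NielsenChuang2010, §2.1.4] -/
theorem eq_zero_of_normSq_eq_zero {ψ : Reg n → ℂ} (h : normSq ψ = 0) : ψ = 0 := by
  unfold normSq at h
  have h' := (Finset.sum_eq_zero_iff_of_nonneg fun x _ => by positivity).1 h
  funext x
  simpa using h' x (Finset.mem_univ x)

/-- A unit vector is non-zero. [cite: NielsenChuang2010, §2.1.4] -/
theorem ne_zero_of_normSq_eq_one {ψ : Reg n → ℂ} (h : normSq ψ = 1) : ψ ≠ 0 := fun h0 => by
  have : normSq ψ = 0 := by simp [normSq, h0]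
  rw [h] at this
  exact one_ne_zero this

/-- Equality case of Cauchy–Schwarz for a Pauli word: if `‖ψ‖² = 1`, `a_S(ψ) = ε` and `|ε| = 1` then
`σ_S ψ = ε ψ` (expand `‖σ_S ψ − ε ψ‖² = 1 − ε conj ε − conj ε ε + |ε|² = 0`). [cite: NielsenChuang2010, §10.5.1] -/
theorem mulVec_eq_smul_of_pauliExp {ψ : Reg n → ℂ} (hψ : normSq ψ = 1) {S : PWord n} {ε : ℂ}
    (hexp : pauliExp ψ S = ε) (hε : ‖ε‖ = 1) : pauliString S *ᵥ ψ = ε • ψ := by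
  set v := pauliString S *ᵥ ψ with hv
  have hvv : star v ⬝ᵥ v = 1 := by rw [← normSq_coe, hv, normSq_mulVec, hψ]; simp
  have hss : star ψ ⬝ᵥ ψ = 1 := by rw [← normSq_coe, hψ]; simp
  have hsv : star ψ ⬝ᵥ v = ε := by rw [hv, ← pauliExp_eq_dotProduct, hexp]
  have hvs : star v ⬝ᵥ ψ = star ε := by rw [← hsv, ← Matrix.star_dotProduct_star, star_star]
  have hεε : ε * star ε = 1 := by rw [Complex.star_def, Complex.mul_conj, Complex.normSq_eq_norm_sq, hε]; simp
  have h0 : (normSq (v - ε • ψ) : ℂ) = 0 := by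
    rw [normSq_coe, star_sub, star_smul, sub_dotProduct, dotProduct_sub, dotProduct_sub,
      smul_dotProduct, dotProduct_smul, dotProduct_smul, smul_dotProduct, hvv, hss, hsv, hvs]
    simp only [smul_eq_mul]
    linear_combination (-1 : ℂ) * hεε
  have h1 : normSq (v - ε • ψ) = 0 := by exact_mod_cast h0
  exact sub_eq_zero.1 (eq_zero_of_normSq_eq_zero h1)

/-- **The stabilizer property.** A UNIT framed state is a joint eigenvector of its `2ⁿ` frame words:
`σ_{w(T)} s = ε_T s` for every `T`. [cite: NielsenChuang2010, §10.5.1] -/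
theorem StabFrame.mulVec_word (F : StabFrame s) (hs : normSq s = 1) (T : Reg n) :
    pauliString (F.word T) *ᵥ s = F.sign T • s :=
  mulVec_eq_smul_of_pauliExp hs (F.pauliExp_word T) (F.norm_sign_eq_one hs T)

/-- … and the eigenvalues are signs: `ε_T² = 1` (apply the word twice, `σ² = 1`). So the signed words
`ε_T σ_{w(T)}`, `T ∈ {0,1}ⁿ`, are `2ⁿ` distinct Pauli-group elements fixing `s`. [cite: AaronsonGottesman2004, §II] -/
theorem StabFrame.sign_sq_eq_one (F : StabFrame s) (hs : normSq s = 1) (T : Reg n) :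
    F.sign T ^ 2 = 1 := by
  have h1 := F.mulVec_word hs T
  have h2 : pauliString (F.word T) *ᵥ (pauliString (F.word T) *ᵥ s) = s := by
    rw [Matrix.mulVec_mulVec, pauliString_mul_self, Matrix.one_mulVec]
  rw [h1, Matrix.mulVec_smul, h1, smul_smul] at h2
  obtain ⟨x, hx⟩ : ∃ x, s x ≠ 0 := by
    by_contra hc
    push Not at hc
    exact ne_zero_of_normSq_eq_one hs (funext hc)
  have h3 := congrFun h2 x
  simp only [Pi.smul_apply, smul_eq_mul] at h3
  have h4 : (F.sign T * F.sign T - 1) * s x = 0 := by rw [sub_mul, h3]; ring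
  rcases mul_eq_zero.1 h4 with h | h
  · rw [sq]; exact sub_eq_zero.1 h
  · exact absurd h hx

/-- `⊗ᵢ (cᵢ • Aᵢ) = (∏ᵢ cᵢ) • ⊗ᵢ Aᵢ`. [cite: NielsenChuang2010, §2.1.7 eq.] -/
theorem tensorAll_smul_fun (c : Fin n → ℂ) (A : Fin n → Matrix Bool Bool ℂ) :
    tensorAll (fun i => c i • A i) = (∏ i, c i) • tensorAll A := by
  ext x y
  simp only [tensorAll_apply, Matrix.smul_apply, smul_eq_mul, Finset.prod_mul_distrib]

/-- The commutation sign of two Pauli words, `χ(S,S') = ∏ᵢ sign(Sᵢ,S'ᵢ)` (tree `Pauli.sign`). [folklore] -/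
def wordSign (S S' : PWord n) : ℂ := ∏ i, Pauli.sign (S i) (S' i)

/-- Conjugation of Pauli words: `σ_S σ_{S'} σ_S = χ(S,S') σ_{S'}` (tree `Pauli.mat_mul_mat_mul_mat` per wire).
[cite: KempeEtAl2010, Observation 4] -/
theorem pauliString_conj (S S' : PWord n) :
    pauliString S * pauliString S' * pauliString S = wordSign S S' • pauliString S' := by
  rw [pauliString_eq, pauliString_eq, tensorAll_mul, tensorAll_mul, wordSign, ← tensorAll_smul_fun]
  congr 1
  funext i
  exact Pauli.mat_mul_mat_mul_mat (S i) (S' i)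

/-- `σ_S σ_{S'} = χ(S,S') σ_{S'} σ_S`. [cite: NielsenChuang2010, §10.5.1] -/
theorem pauliString_mul_comm_sign (S S' : PWord n) :
    pauliString S * pauliString S' = wordSign S S' • (pauliString S' * pauliString S) := by
  have h2 : pauliString S * pauliString S' * pauliString S * pauliString S =
      (wordSign S S' • pauliString S') * pauliString S := by rw [pauliString_conj]
  rwa [Matrix.mul_assoc (pauliString S * pauliString S'), pauliString_mul_self, Matrix.mul_one,
    Matrix.smul_mul] at h2

/-- Two Pauli words with a common NON-ZERO eigenvector (`σ_S v = a v`, `σ_{S'} v = b v`, `b ≠ 0`) commute: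
apply `σ_S σ_{S'} σ_S = χ σ_{S'}` to `v` to get `b v = χ b v`. [cite: NielsenChuang2010, §10.5.1] -/
theorem pauliString_commute_of_common_eigenvector (S S' : PWord n) {v : Reg n → ℂ} (hv : v ≠ 0)
    {a b : ℂ} (ha : pauliString S *ᵥ v = a • v) (hb : pauliString S' *ᵥ v = b • v) (hb0 : b ≠ 0) :
    pauliString S * pauliString S' = pauliString S' * pauliString S := by
  have haa : a • (a • v) = v := by
    have : pauliString S *ᵥ (pauliString S *ᵥ v) = v := by
      rw [Matrix.mulVec_mulVec, pauliString_mul_self, Matrix.one_mulVec]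
    rwa [ha, Matrix.mulVec_smul, ha] at this
  have hL : (pauliString S * pauliString S' * pauliString S) *ᵥ v = b • v := by
    rw [← Matrix.mulVec_mulVec, ← Matrix.mulVec_mulVec, ha, Matrix.mulVec_smul, hb,
      Matrix.mulVec_smul, Matrix.mulVec_smul, ha, smul_comm a b, haa]
  have hR : (wordSign S S' • pauliString S') *ᵥ v = (wordSign S S' * b) • v := by
    rw [Matrix.smul_mulVec, hb, smul_smul]
  rw [pauliString_conj] at hL
  rw [hL] at hR
  have hχ : wordSign S S' = 1 := by
    obtain ⟨x, hx⟩ : ∃ x, v x ≠ 0 := by by_contra hc; push Not at hc; exact hv (funext hc)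
    have h3 := congrFun hR x
    simp only [Pi.smul_apply, smul_eq_mul] at h3
    have h4 : (wordSign S S' - 1) * (b * v x) = 0 := by rw [sub_mul, one_mul, ← mul_assoc, ← h3]; ring
    rcases mul_eq_zero.1 h4 with h | h
    · exact sub_eq_zero.1 h
    · exact absurd h (mul_ne_zero hb0 hx)
  rw [pauliString_mul_comm_sign, hχ, one_smul]

/-- **The frame words of a UNIT framed state PAIRWISE COMMUTE.** With `mulVec_word` / `sign_sq_eq_one`:
the `2ⁿ` distinct signed Pauli words `ε_T σ_{w(T)}` (`ε_T = ±1`, `ε_{0ⁿ} σ_{w(0ⁿ)} = +I`) commute pairwise and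
fix `s` — the textbook definition of an `n`-qubit stabilizer state [Aaronson–Gottesman 2004 §II: «stabilized by
exactly 2ⁿ Pauli operators … which form an abelian group»]; only the closing count (an abelian set of signed Pauli
words fixing a non-zero vector generates a group of order ≤ 2ⁿ, hence these `2ⁿ` words ARE the group) stays prose.
[cite: AaronsonGottesman2004, §II] -/
theorem StabFrame.word_comm (F : StabFrame s) (hs : normSq s = 1) (T T' : Reg n) :
    pauliString (F.word T) * pauliString (F.word T') = pauliString (F.word T') * pauliString (F.word T) := by
  have hb0 : F.sign T' ≠ 0 := fun h => by
    have := F.norm_sign_eq_one hs T'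
    rw [h, norm_zero] at this
    exact zero_ne_one this
  exact pauliString_commute_of_common_eigenvector _ _ (ne_zero_of_normSq_eq_one hs) (F.mulVec_word hs T)
    (F.mulVec_word hs T') hb0

/-! ### (T4c) An entangled inhabitant: the Bell state -/

/-- The Bell amplitude `1/√2`. [folklore] -/
def bellAmp : ℂ := ((1 / Real.sqrt 2 : ℝ) : ℂ)

/-- `(1/√2)·conj(1/√2) = 1/2`. [cite: NielsenChuang2010, §1.3.6 eq.] -/
theorem bellAmp_mul_conj : bellAmp * starRingEnd ℂ bellAmp = 1 / 2 := by
  unfold bellAmp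
  rw [Complex.conj_ofReal, ← Complex.ofReal_mul]
  have h : (1 / Real.sqrt 2) * (1 / Real.sqrt 2) = (1 / 2 : ℝ) := by
    rw [div_mul_div_comm, one_mul, Real.mul_self_sqrt (by norm_num : (0 : ℝ) ≤ 2)]
  rw [h]; push_cast; ring

/-- `|1/√2|² = 1/2`. [cite: NielsenChuang2010, §1.3.6 eq.] -/
theorem norm_bellAmp_sq : ‖bellAmp‖ ^ 2 = 1 / 2 := by
  unfold bellAmp
  rw [Complex.norm_real, Real.norm_eq_abs, sq_abs, div_pow, one_pow,
    Real.sq_sqrt (by norm_num : (0 : ℝ) ≤ 2)]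

/-- The Bell state `|Φ⁺⟩ = (|00⟩ + |11⟩)/√2` on two qubits. [cite: NielsenChuang2010, §1.3.6] -/
def bellKet : Reg 2 → ℂ := fun x => if x 0 = x 1 then bellAmp else 0

/-- The Bell frame letters: `(f,f) ↦ I`, `(t,f) ↦ X`, `(f,t) ↦ Z`, `(t,t) ↦ Y` (repeated on both qubits). [folklore] -/
def bellPauli (a b : Bool) : Pauli :=
  if a = true then (if b = true then Pauli.Y else Pauli.X) else (if b = true then Pauli.Z else Pauli.I)

/-- `bellPauli` is injective on pairs. [cite: NielsenChuang2010, §10.5.1] -/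
theorem bellPauli_inj {a b a' b' : Bool} (h : bellPauli a b = bellPauli a' b') : a = a' ∧ b = b' := by
  unfold bellPauli at h
  cases a <;> cases b <;> cases a' <;> cases b' <;> simp_all

/-- Sums over `{0,1}^{Fin 2}` as double Boolean sums. [cite: NielsenChuang2010, §1.3.6] -/
theorem sum_reg_two {M : Type*} [AddCommMonoid M] (f : Reg 2 → M) :
    ∑ T, f T = ∑ a : Bool, ∑ b : Bool, f (Fin.cons a (Fin.cons b finZeroElim)) := by
  rw [← Equiv.sum_comp (piFinTwoEquiv fun _ => Bool).symm f, Fintype.sum_prod_type]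
  rfl

/-- Entries of a two-qubit Pauli word with the same letter on both qubits. [cite: NielsenChuang2010, §2.1.7] -/
theorem pauliString_const_two (P : Pauli) (x y : Reg 2) :
    pauliString (fun _ : Fin 2 => P) x y = P.mat (x 0) (y 0) * P.mat (x 1) (y 1) := by
  rw [pauliString_eq, tensorAll_apply, Fin.prod_univ_two]

/-- **Entangled non-vacuity**: the Bell state carries the stabilizer frame `{II, XX, −YY, ZZ}`,
`|Φ⁺⟩⟨Φ⁺| = (II + XX − YY + ZZ)/4` (sixteen matrix entries, checked by cases). [cite: NielsenChuang2010, §10.5.1] -/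
def bellFrame : StabFrame bellKet where
  word := fun T _ => bellPauli (T 0) (T 1)
  sign := fun T => if T 0 = true ∧ T 1 = true then -1 else 1
  word_injective := fun T T' h => by
    have h0 := bellPauli_inj (congrFun h 0)
    funext i
    fin_cases i <;> [exact h0.1; exact h0.2]
  word_zero := by funext i; simp [bellPauli, idWord]
  norm_sign_le := fun T => by split_ifs <;> simp
  frame := by
    intro x y
    rw [sum_reg_two]
    simp only [Fintype.sum_bool, Fin.cons_zero, Fin.cons_one, pauliString_const_two, bellPauli,
      bellKet, if_true, Bool.false_eq_true, if_false, and_true, and_false]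
    cases x 0 <;> cases x 1 <;> cases y 0 <;> cases y 1 <;>
      simp [bellAmp_mul_conj] <;> norm_num

/-- The Bell state is a unit vector. [cite: NielsenChuang2010, §1.3.6 eq.] -/
theorem normSq_bellKet : normSq bellKet = 1 := by
  unfold normSq
  rw [sum_reg_two]
  simp only [Fintype.sum_bool, bellKet, Fin.cons_zero, Fin.cons_one]
  simp [norm_bellAmp_sq]
  norm_num

/-- The Bell state is NOT a product state (`Φ⁺(00)Φ⁺(11) = 1/2 ≠ 0 = Φ⁺(01)Φ⁺(10)`).
[cite: NielsenChuang2010, §2.5] -/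
theorem bellKet_not_product : ¬ ∃ u v : Bool → ℂ, ∀ x : Reg 2, bellKet x = u (x 0) * v (x 1) := by
  rintro ⟨u, v, h⟩
  have h00 := h (Fin.cons false (Fin.cons false finZeroElim))
  have h11 := h (Fin.cons true (Fin.cons true finZeroElim))
  have h01 := h (Fin.cons false (Fin.cons true finZeroElim))
  simp only [bellKet, Fin.cons_zero, Fin.cons_one, if_true, Bool.false_eq_true, if_false] at h00 h11 h01
  have hne : bellAmp ≠ 0 := by unfold bellAmp; exact_mod_cast (by positivity : (0 : ℝ) < 1 / Real.sqrt 2).ne'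
  have hsq : bellAmp * bellAmp = 0 := by
    calc bellAmp * bellAmp = (u false * v false) * (u true * v true) := by rw [← h00, ← h11]
      _ = (u false * v true) * (u true * v false) := by ring
      _ = 0 := by rw [← h01]; ring
  exact hne (mul_self_eq_zero.1 hsq)

end Literature.Computability.QuantumComplexity.PauliMoments

end
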